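import Literature.Barriers.CriticalPhenomena.LaceExpansionXSpaceNorms
import Literature.Barriers.CriticalPhenomena.GaussianDominationRouteContinuity
import Literature.Barriers.CriticalPhenomena.GaussianDominationRouteXSpace
import Mathlib.MeasureTheory.Integral.MeanInequalities
import Mathlib.Analysis.MeanInequalities
import HarnessLib

/-!
# Convolution ("diagram") bounds on `ℤ^d` from `L^p` bounds on Fourier representatives
# (for Hara 2008, Lemma 1.7: the Fourier representations (4.4)–(4.8) made rigorous)

Barrier catalogue `Literature/Barriers/CriticalPhenomena/` (D-0021), first support file for the
discharge of the named fact `Hara2008_lemma17Pc` (`LaceExpansionXSpaceNorms.lean`: Hara 2008,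
Lemma 1.7, the finiteness of the weighted diagrams `Ḡ^{(α)}, W̄^{(β,γ)}, T̄^{(β,γ)}, S̄^{(γ)},
H̄^{(β)}` at `p_c`). Hara (§4.1.1) writes the diagrams "in Fourier space",
`W_{jl}^{(β,γ)}(a) = ∫ e^{ika} Ĝ_j^{(β)}(k) Ĝ_l^{(γ)}(k) dk/(2π)^d` ((4.5)), … and reduces
Lemma 1.7 to "integrability of `Ĝ_j^{(β)} Ĝ_l^{(γ)}, …`". Since `G = τ_{p_c}` is not summable,
`Ĝ^{(β)}` is only an `L¹` function on the torus representing `G^{(β)}` through Fourier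
INVERSION, and the convolution identity (4.5) is not available as printed. This file PROVES the
substitute that the proof of Lemma 1.7 actually needs, for NONNEGATIVE lattice functions (as
all `G^{(β)} = |x_j|^β τ_{p_c}(0,x)` are):

* `IsFourierPair f F` — `F ∈ L¹([-π,π]^d)` represents `f : ℤ^d → ℝ`:
  `f(x) = ∫_{[-π,π]^d} e^{ik·x} F(k) dk/(2π)^d` for all `x` (the shape of
  `IsLaceCoefficientPc.repr`, `haraH`);
* **`HaraNorms.ofReal_sum_prod_le`** / **`HaraNorms.tsum_prod_le`** — for `f_1, …, f_n ≥ 0` with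
  Fourier representatives `F_i` and weights `w_i > 0`, `Σ w_i = 1`:
  `sup_a Σ_{y_1+⋯+y_n = a} Π_i f_i(y_i) ≤ (2π)^{-d} Σ_i w_i ∫_{[-π,π]^d} ‖F_i‖^{1/w_i}`
  (an `ℓ^∞` bound on the `n`-fold convolution by Hölder exponents `p_i = 1/w_i`; in `[0, ∞]`).

Mechanism (Fejér regularisation; [folklore]): with `Λ_N = {-N,…,N}^d` and the Fejér weight
`r_N(x) = #{(y,z) ∈ Λ_N² : y - z = x}/|Λ_N|` (`fejerWeight`), whose transform is the Fejér kernel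
`K_N(k) = |Σ_{x∈Λ_N} e^{-ik·x}|²/|Λ_N| ≥ 0` (`fejerKernel`, `sum_fejerWeight_mul_cexp`) of mass
`(2π)^d` and with `r_N(x) → 1`: the functions `f_i r_N` are finitely supported, so
`Σ_{Σy=a} Π (f_i r_N)(y_i) = (2π)^{-d} ∫ e^{ika} Π_i (f_i r_N)^(k) dk` exactly (orthogonality of
characters), `(f_i r_N)^ = (2π)^{-d} F_i ⊛ K_N`, and pointwise Young
`Π A_i ≤ Σ w_i A_i^{1/w_i}` with Jensen `((2π)^{-d}|F| ⊛ K_N)^p ≤ (2π)^{-d}|F|^p ⊛ K_N` and the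
mass of `K_N` give the bound uniformly in `N`; finally `N → ∞` on finite partial sums.

## References

* T. Hara, Ann. Probab. 36 (2008) 530–593 (arXiv:math-ph/0504021): §4.1.1, (4.4)–(4.9)
  ("these quantities are represented in Fourier space as … if we have a good control over
  `Ĝ_j^{(α)}` … so that we can prove integrability of `Ĝ_j^{(α)}, Ĝ_j^{(β)}Ĝ_l^{(γ)}, …`, we are
  done").
-/

noncomputable section

namespace Literature.Barriers.CriticalPhenomena

open _root_.MeasureTheory _root_.Filter _root_.Topology Finset Literature.Probability.LatticeModels
  Literature.Probability.Percolation Literature.Barriers.CriticalPhenomena.Slade2006Prop53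

open scoped ENNReal NNReal

variable {d : ℕ}

/-! ### Fourier representatives on the cube -/

/-- **`F` is a Fourier representative of `f`**: `F` is integrable on `[-π,π]^d` and
`f(x) = ∫_{[-π,π]^d} e^{ik·x} F(k) dk/(2π)^d` for every `x ∈ ℤ^d` (Hara's
`f(x) = ∫ e^{ikx} f̂(k) d^dk/(2π)^d`, §1.1, read as a DEFINITION of the pairing when `f ∉ ℓ¹`; e.g.
`τ_{p_c}(0,·)` and `ĝ/(1-Ĵ)` by `IsLaceCoefficientPc.repr`). [cite: Hara2008, §1.1 Notation and (4.4)] -/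
structure IsFourierPair (f : Site d → ℝ) (F : (Fin d → ℝ) → ℂ) : Prop where
  /-- `F ∈ L¹([-π,π]^d)`. -/
  integrableOn : IntegrableOn F (cube d)
  /-- `f(x) = (2π)^{-d} ∫ e^{ik·x} F(k) dk`. -/
  repr : ∀ x : Site d, (f x : ℂ) =
    (∫ k in cube d, Complex.exp (Complex.I * (kdot k x : ℂ)) * F k) / ((2 * Real.pi : ℂ) ^ d)

namespace HaraNorms

/-! ### Fejér weights and kernels -/

/-- The Fejér count `#{(y,z) ∈ Λ_N × Λ_N : y - z = x}` (`Λ_N = {-N,…,N}^d`). [folklore] -/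
def fejerCount (d N : ℕ) (x : Site d) : ℕ :=
  #((box d N ×ˢ box d N).filter fun yz => yz.1 - yz.2 = x)

/-- The Fejér weight `r_N(x) = #{(y,z) ∈ Λ_N² : y - z = x} / |Λ_N|` (`|Λ_N| = (2N+1)^d`), i.e.
`Π_i (1 - |x_i|/(2N+1))₊`. [folklore] -/
def fejerWeight (d N : ℕ) (x : Site d) : ℝ := (fejerCount d N x : ℝ) / ((2 * N + 1 : ℝ) ^ d)

/-- The Dirichlet sum `Σ_{x ∈ Λ_N} e^{-ik·x}`. [folklore] -/
def dirichletSum (d N : ℕ) (k : Fin d → ℝ) : ℂ :=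
  ∑ x ∈ box d N, Complex.exp (-(Complex.I * (kdot k x : ℂ)))

/-- The Fejér kernel `K_N(k) = |Σ_{x ∈ Λ_N} e^{-ik·x}|² / |Λ_N| ≥ 0`. [folklore] -/
def fejerKernel (d N : ℕ) (k : Fin d → ℝ) : ℝ := ‖dirichletSum d N k‖ ^ 2 / ((2 * N + 1 : ℝ) ^ d)

/-- `|Λ_N| = (2N+1)^d > 0`. [folklore] -/
theorem two_mul_add_one_pow_pos (d N : ℕ) : (0 : ℝ) < (2 * N + 1 : ℝ) ^ d := by positivity

/-- `K_N ≥ 0`. [folklore] -/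
theorem fejerKernel_nonneg (d N : ℕ) (k : Fin d → ℝ) : 0 ≤ fejerKernel d N k :=
  div_nonneg (sq_nonneg _) (two_mul_add_one_pow_pos d N).le

/-- `r_N ≥ 0`. [folklore] -/
theorem fejerWeight_nonneg (d N : ℕ) (x : Site d) : 0 ≤ fejerWeight d N x :=
  div_nonneg (Nat.cast_nonneg _) (two_mul_add_one_pow_pos d N).le

/-- `K_N` is continuous. [folklore] -/
theorem continuous_fejerKernel (d N : ℕ) : Continuous (fejerKernel d N) := by
  unfold fejerKernel dirichletSum
  refine ((continuous_finsetSum _ fun x _ => ?_).norm.pow 2).div_const _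
  have hk : Continuous fun k : Fin d → ℝ => kdot k x := by unfold kdot; fun_prop
  exact Complex.continuous_exp.comp ((Complex.continuous_ofReal.comp hk).const_mul _).neg

/-- `r_N` is supported in `Λ_{2N}`. [folklore] -/
theorem fejerCount_eq_zero {N : ℕ} {x : Site d} (hx : x ∉ box d (2 * N)) : fejerCount d N x = 0 := by
  rw [fejerCount, Finset.card_eq_zero, Finset.filter_eq_empty_iff]
  rintro ⟨y, z⟩ hyz rfl
  rw [Finset.mem_product] at hyz
  exact hx (sub_mem_box_two_mul hyz.1 hyz.2)

/-- `r_N(x) = 0` off `Λ_{2N}`. [folklore] -/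
theorem fejerWeight_eq_zero {N : ℕ} {x : Site d} (hx : x ∉ box d (2 * N)) : fejerWeight d N x = 0 := by
  rw [fejerWeight, fejerCount_eq_zero hx, Nat.cast_zero, zero_div]

/-- **`Σ_x r_N(x) e^{-ik·x} = K_N(k)`**: the Fejér kernel is the transform of the Fejér weight
(`|D|² = D D̄ = Σ_{y,z} e^{-ik·(y-z)}`, grouped along `x = y - z`). [folklore] -/
theorem sum_fejerWeight_mul_cexp (N : ℕ) (k : Fin d → ℝ) :
    ∑ x ∈ box d (2 * N), (fejerWeight d N x : ℂ) * Complex.exp (-(Complex.I * (kdot k x : ℂ))) =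
      (fejerKernel d N k : ℂ) := by
  classical
  set e : Site d → ℂ := fun x => Complex.exp (-(Complex.I * (kdot k x : ℂ))) with he
  have hconj : ∀ x, (starRingEnd ℂ) (e x) = e (-x) := by
    intro x
    rw [he]
    dsimp only
    rw [← Complex.exp_conj, kdot_neg]
    congr 1
    simp [Complex.conj_ofReal]
  have hmul : ∀ y z, e y * e (-z) = e (y - z) := by
    intro y z
    rw [he]
    dsimp only
    rw [← Complex.exp_add, kdot_neg, sub_eq_add_neg, kdot_add, kdot_neg]
    push_cast
    ring_nf
  -- `‖D‖² = Σ_{(y,z)} e(y - z)`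
  have hsq : ((‖dirichletSum d N k‖ ^ 2 : ℝ) : ℂ) = ∑ yz ∈ box d N ×ˢ box d N, e (yz.1 - yz.2) := by
    rw [← Complex.normSq_eq_norm_sq, ← Complex.mul_conj, dirichletSum, map_sum, Finset.sum_mul_sum,
      Finset.sum_product]
    refine Finset.sum_congr rfl fun y _ => Finset.sum_congr rfl fun z _ => ?_
    rw [hconj, hmul]
  -- group along the fibres of `(y,z) ↦ y - z`
  have hfib := Finset.sum_fiberwise_of_maps_to (s := box d N ×ˢ box d N) (t := box d (2 * N))
    (g := fun yz : Site d × Site d => yz.1 - yz.2) (f := fun yz => e (yz.1 - yz.2))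
    (fun yz hyz => by
      rw [Finset.mem_product] at hyz
      exact sub_mem_box_two_mul hyz.1 hyz.2)
  rw [fejerKernel, Complex.ofReal_div, hsq, ← hfib, Finset.sum_div]
  refine Finset.sum_congr rfl fun x _ => ?_
  have hin : ∑ yz ∈ (box d N ×ˢ box d N).filter (fun yz => yz.1 - yz.2 = x), e (yz.1 - yz.2) =
      (fejerCount d N x : ℂ) * e x := by
    rw [Finset.sum_congr rfl (g := fun _ => e x) fun yz hyz => by rw [(Finset.mem_filter.1 hyz).2],
      Finset.sum_const, nsmul_eq_mul, fejerCount]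
  rw [hin, fejerWeight]
  push_cast
  ring

/-- `r_N(0) = 1` (`#{(y,y)} = |Λ_N| = (2N+1)^d`). [folklore] -/
theorem fejerWeight_zero (d N : ℕ) : fejerWeight d N 0 = 1 := by
  classical
  have hcount : fejerCount d N 0 = #(box d N) := by
    rw [fejerCount]
    have : (box d N ×ˢ box d N).filter (fun yz : Site d × Site d => yz.1 - yz.2 = 0) =
        (box d N).map ⟨fun y => (y, y), fun y z h => (Prod.ext_iff.1 h).1⟩ := by
      ext ⟨y, z⟩
      simp only [Finset.mem_filter, Finset.mem_product, Finset.mem_map, Function.Embedding.coeFn_mk,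
        Prod.mk.injEq, sub_eq_zero]
      constructor
      · rintro ⟨⟨hy, -⟩, rfl⟩
        exact ⟨y, hy, rfl, rfl⟩
      · rintro ⟨w, hw, rfl, rfl⟩
        exact ⟨⟨hw, hw⟩, rfl⟩
    rw [this, Finset.card_map]
  rw [fejerWeight, hcount, card_box]
  push_cast
  exact div_self (two_mul_add_one_pow_pos d N).ne'

/-- The count dominates a smaller box: for `x ∈ Λ_m` and `z ∈ Λ_{N-m}` the pair `(z + x, z)`
is counted, so `#Λ_{N-m} ≤ fejerCount N x` (`m ≤ N`). [folklore] -/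
theorem card_box_le_fejerCount {N m : ℕ} (hm : m ≤ N) {x : Site d} (hx : x ∈ box d m) :
    #(box d (N - m)) ≤ fejerCount d N x := by
  classical
  rw [fejerCount]
  refine Finset.card_le_card_of_injOn (fun z => (z + x, z)) (fun z hz => ?_) (fun z _ z' _ h => by
    simpa using (Prod.ext_iff.1 h).2)
  rw [Finset.mem_coe, mem_box] at hz
  rw [mem_box] at hx
  change (z + x, z) ∈ _
  rw [Finset.mem_coe, Finset.mem_filter, Finset.mem_product, mem_box, mem_box]
  refine ⟨⟨fun i => ?_, fun i => ?_⟩, by simp⟩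
  · have h1 := hz i; have h2 := hx i
    simp only [Pi.add_apply]
    constructor <;> omega
  · have h1 := hz i
    push_cast at h1 ⊢
    constructor <;> omega

/-- The count is at most `|Λ_N|` (for each `z` at most one `y`). [folklore] -/
theorem fejerCount_le_card_box (N : ℕ) (x : Site d) : fejerCount d N x ≤ #(box d N) := by
  classical
  rw [fejerCount]
  refine Finset.card_le_card_of_injOn Prod.snd (fun yz hyz => ?_) (fun yz hyz yz' hyz' h => ?_)
  · rw [Finset.mem_coe, Finset.mem_filter, Finset.mem_product] at hyz
    exact hyz.1.2
  · rw [Finset.mem_coe, Finset.mem_filter] at hyz hyz'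
    have h2 : yz.2 = yz'.2 := h
    have h1 : yz.1 = yz'.1 := by
      rw [← sub_add_cancel yz.1 yz.2, ← sub_add_cancel yz'.1 yz'.2, hyz.2, hyz'.2, h2]
    exact Prod.ext h1 h2

/-- `r_N ≤ 1`. [folklore] -/
theorem fejerWeight_le_one (N : ℕ) (x : Site d) : fejerWeight d N x ≤ 1 := by
  rw [fejerWeight, div_le_one (two_mul_add_one_pow_pos d N)]
  have h := fejerCount_le_card_box N x
  rw [card_box] at h
  exact_mod_cast h

/-- **`r_N(x) → 1`** as `N → ∞`, for every `x` (squeezed between `(|Λ_{N-m}|/|Λ_N|)` and `1`,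
`m = ‖x‖_∞`). [folklore] -/
theorem tendsto_fejerWeight (x : Site d) : Tendsto (fun N => fejerWeight d N x) atTop (𝓝 1) := by
  classical
  -- `x ∈ Λ_m`
  obtain ⟨m, hm⟩ : ∃ m : ℕ, x ∈ box d m := by
    have hx : x ∈ ⋃ L : ℕ, ((box d L : Finset (Site d)) : Set (Site d)) := by
      rw [iUnion_coe_box]; exact Set.mem_univ x
    simpa using hx
  -- the lower bound `((2(N-m)+1)/(2N+1))^d`
  have hlow : ∀ N, m ≤ N → ((2 * (N - m : ℕ) + 1 : ℝ) / (2 * N + 1)) ^ d ≤ fejerWeight d N x := by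
    intro N hN
    rw [div_pow, fejerWeight, div_le_div_iff_of_pos_right (two_mul_add_one_pow_pos d N)]
    have h := card_box_le_fejerCount hN hm
    rw [card_box] at h
    exact_mod_cast h
  have hlim : Tendsto (fun N : ℕ => ((2 * (N - m : ℕ) + 1 : ℝ) / (2 * N + 1)) ^ d) atTop (𝓝 1) := by
    rw [show (1 : ℝ) = 1 ^ d by simp]
    refine Tendsto.pow ?_ d
    -- `(2(N-m)+1)/(2N+1) = 1 - 2m/(2N+1)` for `N ≥ m`
    have h1 : Tendsto (fun N : ℕ => 1 - 2 * (m : ℝ) / (2 * N + 1)) atTop (𝓝 (1 - 0)) := by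
      refine tendsto_const_nhds.sub ?_
      have h2 : Tendsto (fun N : ℕ => (2 * (N : ℝ) + 1)) atTop atTop :=
        tendsto_atTop_add_const_right _ 1 (tendsto_natCast_atTop_atTop.const_mul_atTop two_pos)
      have h3 := h2.inv_tendsto_atTop.const_mul (2 * (m : ℝ))
      rw [mul_zero] at h3
      exact h3.congr fun N => (div_eq_mul_inv _ _).symm
    rw [sub_zero] at h1
    refine h1.congr' ?_
    filter_upwards [eventually_ge_atTop m] with N hN
    rw [Nat.cast_sub hN]
    field_simp
    ring
  refine tendsto_of_tendsto_of_tendsto_of_le_of_le' hlim tendsto_const_nhds ?_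
    (Eventually.of_forall fun N => fejerWeight_le_one N x)
  filter_upwards [eventually_ge_atTop m] with N hN using hlow N hN

/-- `K_N` is even. [folklore] -/
theorem fejerKernel_neg (N : ℕ) (k : Fin d → ℝ) : fejerKernel d N (-k) = fejerKernel d N k := by
  have h : dirichletSum d N (-k) = (starRingEnd ℂ) (dirichletSum d N k) := by
    rw [dirichletSum, dirichletSum, map_sum]
    refine Finset.sum_congr rfl fun x _ => ?_
    rw [← Complex.exp_conj]
    congr 1
    have : kdot (-k) x = -kdot k x := by
      simp only [kdot, Pi.neg_apply, neg_mul, Finset.sum_neg_distrib]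
    simp [Complex.conj_ofReal, this]
  rw [fejerKernel, fejerKernel, h, Complex.norm_conj]

/-- `∫_{[-π,π]^d} e^{ik·a} e^{-ik·w} dk = (2π)^d 𝟙{w = a}` (orthogonality). [folklore] -/
theorem integral_cexp_kdot_mul_cexp_neg_kdot (a w : Site d) :
    ∫ k in cube d, Complex.exp (Complex.I * (kdot k a : ℂ)) * Complex.exp (-(Complex.I * (kdot k w : ℂ))) =
      if w = a then ((2 * Real.pi) ^ d : ℂ) else 0 := by
  rw [show (volume.restrict (cube d) : Measure (Fin d → ℝ)) = P d from volume_restrict_cube d]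
  have h := integral_cexp_neg_kdot (d := d) (w - a)
  have hint : ∫ k, Complex.exp (Complex.I * (kdot k a : ℂ)) * Complex.exp (-(Complex.I * (kdot k w : ℂ))) ∂P d =
      ∫ k, Complex.exp (-(Complex.I * ((kdot k (w - a) : ℝ) : ℂ))) ∂P d := by
    refine integral_congr_ae (Eventually.of_forall fun k => ?_)
    dsimp only
    rw [← Complex.exp_add, sub_eq_add_neg, kdot_add, kdot_neg]
    push_cast
    ring_nf
  rw [hint, h]
  by_cases hw : w = a
  · simp [hw]
  · simp [hw, sub_eq_zero]

/-- **Mass of the Fejér kernel**: `∫_{[-π,π]^d} K_N(k - c) dk = (2π)^d` for every `c`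
(term-by-term: only `x = 0` survives, and `r_N(0) = 1`). [folklore] -/
theorem integral_fejerKernel_sub (N : ℕ) (c : Fin d → ℝ) :
    ∫ k in cube d, fejerKernel d N (k - c) = (2 * Real.pi) ^ d := by
  have hC : ∫ k in cube d, (fejerKernel d N (k - c) : ℂ) = ((2 * Real.pi) ^ d : ℂ) := by
    simp_rw [← sum_fejerWeight_mul_cexp, kdot_sub_left]
    rw [integral_finsetSum _ fun x _ => ?_]
    · have hx : ∀ x ∈ box d (2 * N), ∫ k in cube d, (fejerWeight d N x : ℂ) *
          Complex.exp (-(Complex.I * ((kdot k x - kdot c x : ℝ) : ℂ))) =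
          (fejerWeight d N x : ℂ) * Complex.exp (Complex.I * (kdot c x : ℂ)) *
            (if x = 0 then ((2 * Real.pi) ^ d : ℂ) else 0) := by
        intro x _
        rw [← integral_cexp_kdot_mul_cexp_neg_kdot (0 : Site d) x, ← integral_const_mul]
        refine integral_congr_ae (Eventually.of_forall fun k => ?_)
        simp only [kdot_zero_right, Complex.ofReal_zero, mul_zero, Complex.exp_zero, one_mul]
        rw [mul_assoc, ← Complex.exp_add]
        push_cast
        ring_nf
      rw [Finset.sum_congr rfl hx, Finset.sum_eq_single (0 : Site d)]
      · simp [fejerWeight_zero]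
      · intro x _ hx0
        simp [hx0]
      · intro h
        exact absurd (zero_mem_box d (2 * N)) h
    · have hk : Continuous fun k : Fin d → ℝ => kdot k x := by unfold kdot; fun_prop
      have hc : Continuous fun k : Fin d → ℝ => (fejerWeight d N x : ℂ) *
          Complex.exp (-(Complex.I * ((kdot k x - kdot c x : ℝ) : ℂ))) :=
        continuous_const.mul (Complex.continuous_exp.comp
          ((Complex.continuous_ofReal.comp (hk.sub continuous_const)).const_mul _).neg)
      exact hc.continuousOn.integrableOn_compact (isCompact_univ_pi fun _ => isCompact_Icc)
  have hR : ∫ k in cube d, (fejerKernel d N (k - c) : ℂ) = ((∫ k in cube d, fejerKernel d N (k - c) : ℝ) : ℂ) :=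
    integral_ofReal
  rw [hR] at hC
  exact_mod_cast hC

/-- Mass of the Fejér kernel in `[0, ∞]`: `∫⁻ K_N(k - c) dk = (2π)^d`. [folklore] -/
theorem lintegral_fejerKernel_sub (N : ℕ) (c : Fin d → ℝ) :
    ∫⁻ k in cube d, ENNReal.ofReal (fejerKernel d N (k - c)) = ENNReal.ofReal ((2 * Real.pi) ^ d) := by
  have hc : Continuous fun k : Fin d → ℝ => fejerKernel d N (k - c) :=
    (continuous_fejerKernel d N).comp (continuous_id.sub continuous_const)
  rw [← integral_fejerKernel_sub N c, ofReal_integral_eq_lintegral_ofReal]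
  · exact hc.continuousOn.integrableOn_compact (isCompact_univ_pi fun _ => isCompact_Icc)
  · exact Eventually.of_forall fun k => fejerKernel_nonneg d N _

/-- Mass in the other variable: `∫⁻ K_N(c - k') dk' = (2π)^d`. [folklore] -/
theorem lintegral_fejerKernel_sub' (N : ℕ) (c : Fin d → ℝ) :
    ∫⁻ k' in cube d, ENNReal.ofReal (fejerKernel d N (c - k')) = ENNReal.ofReal ((2 * Real.pi) ^ d) := by
  simp_rw [show ∀ k' : Fin d → ℝ, c - k' = -(k' - c) from fun k' => (neg_sub k' c).symm, fejerKernel_neg]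
  exact lintegral_fejerKernel_sub N c

/-! ### The transform of `f · r_N` is the smoothed representative `(2π)^{-d} F ⊛ K_N` -/

/-- `(2π)^{-d} (F ⊛ K_N)(k) = ∫_{[-π,π]^d} F(k') K_N(k - k') dk' / (2π)^d`. [folklore] -/
def smoothedFT (d N : ℕ) (F : (Fin d → ℝ) → ℂ) (k : Fin d → ℝ) : ℂ :=
  (∫ k' in cube d, F k' * (fejerKernel d N (k - k') : ℂ)) / ((2 * Real.pi : ℂ) ^ d)

/-- **`(f r_N)^ = (2π)^{-d} F ⊛ K_N`** for a Fourier pair `(f, F)`: expand `f(y)` by the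
representation and sum the finitely many characters against `r_N`. [folklore] -/
theorem sum_mul_fejerWeight_mul_cexp {f : Site d → ℝ} {F : (Fin d → ℝ) → ℂ} (h : IsFourierPair f F)
    (N : ℕ) (k : Fin d → ℝ) :
    ∑ y ∈ box d (2 * N), ((f y * fejerWeight d N y : ℝ) : ℂ) * Complex.exp (-(Complex.I * (kdot k y : ℂ))) =
      smoothedFT d N F k := by
  -- each term is an integral
  have hterm : ∀ y, ((f y * fejerWeight d N y : ℝ) : ℂ) * Complex.exp (-(Complex.I * (kdot k y : ℂ))) =
      (∫ k' in cube d, (fejerWeight d N y : ℂ) * Complex.exp (-(Complex.I * (kdot k y : ℂ))) *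
        (Complex.exp (Complex.I * (kdot k' y : ℂ)) * F k')) / ((2 * Real.pi : ℂ) ^ d) := by
    intro y
    rw [integral_const_mul, mul_div_assoc, ← h.repr y]
    push_cast
    ring
  have hint : ∀ y, Integrable (fun k' => (fejerWeight d N y : ℂ) * Complex.exp (-(Complex.I * (kdot k y : ℂ))) *
      (Complex.exp (Complex.I * (kdot k' y : ℂ)) * F k')) (volume.restrict (cube d)) :=
    fun y => (integrableOn_cexp_kdot_mul h.integrableOn y).const_mul _
  simp_rw [hterm]
  rw [← Finset.sum_div, ← integral_finsetSum _ fun y _ => hint y, smoothedFT]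
  congr 1
  refine integral_congr_ae (Eventually.of_forall fun k' => ?_)
  dsimp only
  rw [← sum_fejerWeight_mul_cexp N (k - k'), Finset.mul_sum]
  refine Finset.sum_congr rfl fun y _ => ?_
  rw [kdot_sub_left]
  rw [show ∀ a b c e : ℂ, a * b * (c * e) = e * (a * (b * c)) from fun a b c e => by ring, ← Complex.exp_add]
  congr 3
  push_cast
  ring

/-- `‖(2π)^{-d} (F ⊛ K_N)(k)‖ ≤ (2π)^{-d} ∫⁻ ‖F(k')‖ K_N(k - k') dk'`. [folklore] -/
theorem enorm_smoothedFT_le (N : ℕ) (F : (Fin d → ℝ) → ℂ) (k : Fin d → ℝ) :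
    ‖smoothedFT d N F k‖ₑ ≤
      (∫⁻ k' in cube d, ‖F k'‖ₑ * ENNReal.ofReal (fejerKernel d N (k - k'))) / ENNReal.ofReal ((2 * Real.pi) ^ d) := by
  have hpos : (0 : ℝ) < (2 * Real.pi) ^ d := by positivity
  have hnorm : ‖((2 * Real.pi : ℂ) ^ d)‖ = (2 * Real.pi) ^ d := by
    rw [show ((2 * Real.pi : ℂ) ^ d) = (((2 * Real.pi) ^ d : ℝ) : ℂ) by push_cast; ring, Complex.norm_real,
      Real.norm_of_nonneg hpos.le]
  rw [smoothedFT, ← ofReal_norm, norm_div, hnorm, ENNReal.ofReal_div_of_pos hpos, ofReal_norm]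
  gcongr
  refine (enorm_integral_le_lintegral_enorm _).trans (lintegral_mono fun k' => le_of_eq ?_)
  rw [enorm_mul, ← ofReal_norm ((fejerKernel d N (k - k') : ℝ) : ℂ), Complex.norm_real,
    Real.norm_of_nonneg (fejerKernel_nonneg d N _)]

/-! ### Young's inequality in `[0, ∞]` and Jensen's inequality for the Fejér average -/

/-- **Weighted AM–GM / Young in `[0, ∞]`**: `Π_i A_i ≤ Σ_i w_i A_i^{1/w_i}` for weights `w_i > 0`
with `Σ w_i = 1`. [folklore] -/
theorem prod_le_sum_mul_rpow {ι : Type*} (s : Finset ι) {w : ι → ℝ} (hw : ∀ i ∈ s, 0 < w i)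
    (hw1 : ∑ i ∈ s, w i = 1) (A : ι → ℝ≥0∞) :
    ∏ i ∈ s, A i ≤ ∑ i ∈ s, ENNReal.ofReal (w i) * A i ^ (1 / w i) := by
  classical
  by_cases htop : ∃ i ∈ s, A i = ∞
  · obtain ⟨i, hi, hA⟩ := htop
    refine le_top.trans (le_of_eq ?_) |>.trans
      (Finset.single_le_sum (f := fun i => ENNReal.ofReal (w i) * A i ^ (1 / w i)) (fun _ _ => zero_le) hi)
    rw [hA, ENNReal.top_rpow_of_pos (one_div_pos.2 (hw i hi)), ENNReal.mul_top]
    simpa using hw i hi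
  push Not at htop
  -- all finite: lift to `ℝ≥0`
  set a : ι → ℝ≥0 := fun i => (A i).toNNReal with ha
  have hA : ∀ i ∈ s, A i = (a i : ℝ≥0∞) := fun i hi => (ENNReal.coe_toNNReal (htop i hi)).symm
  set w' : ι → ℝ≥0 := fun i => (w i).toNNReal with hw'
  have hww : ∀ i ∈ s, ((w' i : ℝ≥0) : ℝ) = w i := fun i hi => Real.coe_toNNReal _ (hw i hi).le
  have hw1' : ∑ i ∈ s, w' i = 1 := by
    rw [← NNReal.coe_inj, NNReal.coe_sum, NNReal.coe_one, ← hw1]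
    exact Finset.sum_congr rfl hww
  have key := NNReal.geom_mean_le_arith_mean_weighted s w' (fun i => a i ^ (1 / w i)) hw1'
  have hl : ∏ i ∈ s, (a i ^ (1 / w i)) ^ ((w' i : ℝ≥0) : ℝ) = ∏ i ∈ s, a i := by
    refine Finset.prod_congr rfl fun i hi => ?_
    rw [← NNReal.rpow_mul, hww i hi, one_div_mul_cancel (hw i hi).ne', NNReal.rpow_one]
  rw [hl] at key
  calc ∏ i ∈ s, A i = ∏ i ∈ s, (a i : ℝ≥0∞) := Finset.prod_congr rfl hA
    _ = ((∏ i ∈ s, a i : ℝ≥0) : ℝ≥0∞) := (ENNReal.ofNNReal_finsetProd _ _).symm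
    _ ≤ ((∑ i ∈ s, w' i * a i ^ (1 / w i) : ℝ≥0) : ℝ≥0∞) := ENNReal.coe_le_coe.2 key
    _ = ∑ i ∈ s, ENNReal.ofReal (w i) * A i ^ (1 / w i) := by
        rw [ENNReal.ofNNReal_finsetSum]
        refine Finset.sum_congr rfl fun i hi => ?_
        rw [ENNReal.coe_mul, ENNReal.coe_rpow_of_nonneg _ (one_div_pos.2 (hw i hi)).le, ← hA i hi,
          ENNReal.ofReal, hw']

/-- **Jensen's inequality for a kernel average in `[0, ∞]`**: if `∫⁻ K = M ∈ (0, ∞)` and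
`p ≥ 1` then `((∫⁻ g K)/M)^p ≤ (∫⁻ g^p K)/M` (Hölder with `K = K^{1/p} K^{1/q}`). [folklore] -/
theorem rpow_lintegral_mul_div_le {α : Type*} [MeasurableSpace α] {μ : Measure α} {K g : α → ℝ≥0∞}
    (hK : AEMeasurable K μ) (hg : AEMeasurable g μ) {M : ℝ≥0∞} (hM : ∫⁻ x, K x ∂μ = M)
    (hM0 : M ≠ 0) (hMt : M ≠ ∞) {p : ℝ} (hp : 1 ≤ p) :
    ((∫⁻ x, g x * K x ∂μ) / M) ^ p ≤ (∫⁻ x, g x ^ p * K x ∂μ) / M := by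
  rcases hp.eq_or_lt with rfl | hp1
  · simp
  have hpq := Real.HolderConjugate.conjExponent hp1
  set q := p.conjExponent with hq
  have hp0 : 0 < p := hpq.pos
  have hq0 : 0 < q := hpq.symm.pos
  have hpinv : p⁻¹ + q⁻¹ = 1 := hpq.inv_add_inv_eq_one
  -- Hölder
  have hsplit : ∀ x, g x * K x = (g x * K x ^ (1 / p)) * K x ^ (1 / q) := by
    intro x
    rw [mul_assoc, ← ENNReal.rpow_add_of_nonneg _ _ (by positivity) (by positivity), one_div, one_div,
      hpinv, ENNReal.rpow_one]
  have hH := ENNReal.lintegral_mul_le_Lp_mul_Lq μ hpq (f := fun x => g x * K x ^ (1 / p))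
    (g := fun x => K x ^ (1 / q)) (hg.mul (hK.pow_const _)) (hK.pow_const _)
  have hf1 : ∀ x, (g x * K x ^ (1 / p)) ^ p = g x ^ p * K x := by
    intro x
    rw [ENNReal.mul_rpow_of_nonneg _ _ hp0.le, one_div, ENNReal.rpow_inv_rpow hp0.ne']
  have hf2 : ∀ x, (K x ^ (1 / q)) ^ q = K x := by
    intro x
    rw [one_div, ENNReal.rpow_inv_rpow hq0.ne']
  simp only [Pi.mul_apply, hf1, hf2, hM] at hH
  simp_rw [hsplit]
  set X := ∫⁻ x, g x ^ p * K x ∂μ with hX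
  -- `M = M^{1/p} M^{1/q}`
  have hMsplit : M = M ^ (1 / p) * M ^ (1 / q) := by
    rw [← ENNReal.rpow_add_of_nonneg _ _ (by positivity) (by positivity), one_div, one_div, hpinv,
      ENNReal.rpow_one]
  have hMq0 : M ^ (1 / q) ≠ 0 := by simp [hM0, hq0.le]
  have hMqt : M ^ (1 / q) ≠ ∞ := by simp [hMt, hq0.le]
  have h1 : (∫⁻ x, g x * K x ^ (1 / p) * K x ^ (1 / q) ∂μ) / M ≤ (X / M) ^ (1 / p) := by
    calc (∫⁻ x, g x * K x ^ (1 / p) * K x ^ (1 / q) ∂μ) / M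
        ≤ X ^ (1 / p) * M ^ (1 / q) / M := by gcongr
      _ = X ^ (1 / p) * M ^ (1 / q) / (M ^ (1 / p) * M ^ (1 / q)) := by rw [← hMsplit]
      _ = X ^ (1 / p) / M ^ (1 / p) := ENNReal.mul_div_mul_right _ _ hMq0 hMqt
      _ = (X / M) ^ (1 / p) := (ENNReal.div_rpow_of_nonneg _ _ (by positivity)).symm
  calc ((∫⁻ x, g x * K x ^ (1 / p) * K x ^ (1 / q) ∂μ) / M) ^ p
      ≤ ((X / M) ^ (1 / p)) ^ p := ENNReal.rpow_le_rpow h1 hp0.le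
    _ = X / M := by rw [one_div, ENNReal.rpow_inv_rpow hp0.ne']

/-! ### The regularised diagram as a Fourier integral -/

/-- `k·(Σ_i y_i) = Σ_i k·y_i`. [folklore] -/
theorem kdot_finset_sum {ι : Type*} (s : Finset ι) (k : Fin d → ℝ) (y : ι → Site d) :
    kdot k (∑ i ∈ s, y i) = ∑ i ∈ s, kdot k (y i) := by
  induction s using Finset.cons_induction with
  | empty => simp
  | cons a s ha ih => rw [Finset.sum_cons, kdot_add, ih, Finset.sum_cons]

/-- **The constrained sum of a product of finitely supported functions is a Fourier integral**:
`Σ_{y ∈ Λ_L^n, Σ y_i = a} Π_i c_i(y_i) = (2π)^{-d} ∫ e^{ik·a} Π_i (Σ_{y∈Λ_L} c_i(y) e^{-ik·y}) dk`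
(expand the product and use the orthogonality of characters). [folklore] -/
theorem sum_filter_prod_eq_integral {n : ℕ} (L : ℕ) (c : Fin n → Site d → ℝ) (a : Site d) :
    (((∑ y ∈ (Fintype.piFinset fun _ : Fin n => box d L) with (∑ i, y i = a), ∏ i, c i (y i) : ℝ)) : ℂ) =
      (∫ k in cube d, Complex.exp (Complex.I * (kdot k a : ℂ)) *
        ∏ i, ∑ y ∈ box d L, (c i y : ℂ) * Complex.exp (-(Complex.I * (kdot k y : ℂ)))) /
        ((2 * Real.pi : ℂ) ^ d) := by
  classical
  set T := Fintype.piFinset fun _ : Fin n => box d L with hT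
  -- expand the product of sums
  have hexp : ∀ k : Fin d → ℝ, ∏ i, ∑ y ∈ box d L, (c i y : ℂ) * Complex.exp (-(Complex.I * (kdot k y : ℂ))) =
      ∑ p ∈ T, (∏ i, (c i (p i) : ℂ)) * Complex.exp (-(Complex.I * (kdot k (∑ i, p i) : ℂ))) := by
    intro k
    rw [Finset.prod_univ_sum]
    refine Finset.sum_congr rfl fun p _ => ?_
    rw [Finset.prod_mul_distrib, ← Complex.exp_sum, kdot_finset_sum]
    congr 1
    push_cast
    rw [Finset.mul_sum, Finset.sum_neg_distrib]
  simp_rw [hexp, Finset.mul_sum]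
  have hint : ∀ p ∈ T, Integrable (fun k : Fin d → ℝ => Complex.exp (Complex.I * (kdot k a : ℂ)) *
      ((∏ i, (c i (p i) : ℂ)) * Complex.exp (-(Complex.I * (kdot k (∑ i, p i) : ℂ)))))
      (volume.restrict (cube d)) := by
    intro p _
    have hk : ∀ z : Site d, Continuous fun k : Fin d → ℝ => kdot k z := fun z => by unfold kdot; fun_prop
    have hc : Continuous fun k : Fin d → ℝ => Complex.exp (Complex.I * (kdot k a : ℂ)) *
        ((∏ i, (c i (p i) : ℂ)) * Complex.exp (-(Complex.I * (kdot k (∑ i, p i) : ℂ)))) :=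
      (Complex.continuous_exp.comp ((Complex.continuous_ofReal.comp (hk a)).const_mul _)).mul
        (continuous_const.mul (Complex.continuous_exp.comp
          ((Complex.continuous_ofReal.comp (hk _)).const_mul _).neg))
    exact hc.continuousOn.integrableOn_compact (isCompact_univ_pi fun _ => isCompact_Icc)
  rw [integral_finsetSum _ hint]
  have hp : ∀ p ∈ T, ∫ k in cube d, Complex.exp (Complex.I * (kdot k a : ℂ)) *
      ((∏ i, (c i (p i) : ℂ)) * Complex.exp (-(Complex.I * (kdot k (∑ i, p i) : ℂ)))) =
      (∏ i, (c i (p i) : ℂ)) * if ∑ i, p i = a then ((2 * Real.pi) ^ d : ℂ) else 0 := by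
    intro p _
    rw [← integral_cexp_kdot_mul_cexp_neg_kdot a (∑ i, p i), ← integral_const_mul]
    refine integral_congr_ae (Eventually.of_forall fun k => ?_)
    dsimp only
    ring
  rw [Finset.sum_congr rfl hp, Finset.sum_div, Finset.sum_filter]
  push_cast
  refine Finset.sum_congr rfl fun p _ => ?_
  have h2pi : ((2 * Real.pi) ^ d : ℂ) ≠ 0 := pow_ne_zero _ (by exact_mod_cast Real.two_pi_pos.ne')
  split_ifs <;> simp [h2pi]

/-! ### The diagram bound -/

/-- Every finite set of `n`-tuples of lattice points lies in some `Λ_L^n`. [folklore] -/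
theorem exists_subset_piFinset_box {n : ℕ} (S : Finset (Fin n → Site d)) :
    ∃ L : ℕ, ∀ y ∈ S, ∀ i, y i ∈ box d L := by
  classical
  have hy : ∀ y : Fin n → Site d, ∃ m : ℕ, ∀ i, y i ∈ box d m := by
    intro y
    have h1 : ∀ i, ∃ m : ℕ, y i ∈ box d m := fun i => by
      have hx : y i ∈ ⋃ L : ℕ, ((box d L : Finset (Site d)) : Set (Site d)) := by
        rw [iUnion_coe_box]; exact Set.mem_univ _
      simpa using hx
    choose m hm using h1
    refine ⟨Finset.univ.sup m, fun i => box_mono d (Finset.le_sup (Finset.mem_univ i)) (hm i)⟩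
  choose m hm using hy
  refine ⟨S.sup m, fun y hy i => box_mono d (Finset.le_sup hy) (hm y i)⟩

/-- Weights of a convex combination are at most `1`. [folklore] -/
theorem weight_le_one {n : ℕ} {w : Fin n → ℝ} (hw : ∀ i, 0 < w i) (hw1 : ∑ i, w i = 1) (i : Fin n) :
    w i ≤ 1 := by
  rw [← hw1]
  exact Finset.single_le_sum (fun j _ => (hw j).le) (Finset.mem_univ i)

/-- The uniform bound on the regularised diagrams: for every `N`,
`Σ_{y ∈ Λ_{2N}^n, Σy = a} Π_i f_i(y_i) r_N(y_i) ≤ (2π)^{-d} Σ_i w_i ∫ ‖F_i‖^{1/w_i}`. [folklore] -/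
theorem ofReal_sum_prod_fejerWeight_le {n : ℕ} {f : Fin n → Site d → ℝ} {F : Fin n → (Fin d → ℝ) → ℂ}
    (hfF : ∀ i, IsFourierPair (f i) (F i)) (hf : ∀ i y, 0 ≤ f i y)
    {w : Fin n → ℝ} (hw : ∀ i, 0 < w i) (hw1 : ∑ i, w i = 1) (a : Site d) (N : ℕ) :
    ENNReal.ofReal (∑ y ∈ (Fintype.piFinset fun _ : Fin n => box d (2 * N)) with (∑ i, y i = a),
        ∏ i, f i (y i) * fejerWeight d N (y i)) ≤
      (∑ i, ENNReal.ofReal (w i) * ∫⁻ k in cube d, ‖F i k‖ₑ ^ (1 / w i)) / ENNReal.ofReal ((2 * Real.pi) ^ d) := by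
  classical
  set M : ℝ≥0∞ := ENNReal.ofReal ((2 * Real.pi) ^ d) with hM
  have hMpos : (0 : ℝ) < (2 * Real.pi) ^ d := by positivity
  have hM0 : M ≠ 0 := by rw [hM]; exact (ENNReal.ofReal_pos.2 hMpos).ne'
  have hMt : M ≠ ∞ := ENNReal.ofReal_ne_top
  set μ : Measure (Fin d → ℝ) := volume.restrict (cube d) with hμ
  set K : (Fin d → ℝ) → ℝ≥0∞ := fun q => ENNReal.ofReal (fejerKernel d N q) with hK
  have hKm : Measurable K := ENNReal.measurable_ofReal.comp (continuous_fejerKernel d N).measurable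
  -- the real sum is nonnegative and equals a Fourier integral
  set Φ : ℝ := ∑ y ∈ (Fintype.piFinset fun _ : Fin n => box d (2 * N)) with (∑ i, y i = a),
    ∏ i, f i (y i) * fejerWeight d N (y i) with hΦ
  have hΦ0 : 0 ≤ Φ := Finset.sum_nonneg fun y _ => Finset.prod_nonneg fun i _ =>
    mul_nonneg (hf i _) (fejerWeight_nonneg d N _)
  have hid := sum_filter_prod_eq_integral (2 * N) (fun i y => f i y * fejerWeight d N y) a
  simp_rw [sum_mul_fejerWeight_mul_cexp (hfF _)] at hid
  -- `ofReal Φ = ‖Φ‖ₑ ≤ (∫⁻ Π ‖S_i‖)/M`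
  have hΦC : ((Φ : ℝ) : ℂ) = (∫ k in cube d, Complex.exp (Complex.I * (kdot k a : ℂ)) *
      ∏ i, smoothedFT d N (F i) k) / ((2 * Real.pi : ℂ) ^ d) := by
    rw [hΦ]; exact hid
  have h1 : ENNReal.ofReal Φ ≤ (∫⁻ k, ∏ i, ‖smoothedFT d N (F i) k‖ₑ ∂μ) / M := by
    rw [show ENNReal.ofReal Φ = ‖((Φ : ℝ) : ℂ)‖ₑ by
      rw [← ofReal_norm, Complex.norm_real, Real.norm_of_nonneg hΦ0], hΦC, hM, ← ofReal_norm, norm_div,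
      show ‖((2 * Real.pi : ℂ) ^ d)‖ = (2 * Real.pi) ^ d by
        rw [show ((2 * Real.pi : ℂ) ^ d) = (((2 * Real.pi) ^ d : ℝ) : ℂ) by push_cast; ring, Complex.norm_real,
          Real.norm_of_nonneg hMpos.le],
      ENNReal.ofReal_div_of_pos hMpos, ofReal_norm]
    gcongr
    refine (enorm_integral_le_lintegral_enorm _).trans (lintegral_mono fun k => le_of_eq ?_)
    rw [enorm_mul, show ‖Complex.exp (Complex.I * (kdot k a : ℂ))‖ₑ = 1 by
      rw [← ofReal_norm, norm_cexp_I_mul_kdot, ENNReal.ofReal_one], one_mul, ← ofReal_norm, norm_prod,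
      ENNReal.ofReal_prod_of_nonneg fun i _ => norm_nonneg _]
    exact Finset.prod_congr rfl fun i _ => ofReal_norm _
  -- the averaged majorants `A_i(k) = (∫⁻ ‖F_i‖ K(k-·))/M`
  set A : Fin n → (Fin d → ℝ) → ℝ≥0∞ := fun i k => (∫⁻ k', ‖F i k'‖ₑ * K (k - k') ∂μ) / M with hA
  set Bf : Fin n → (Fin d → ℝ) → ℝ≥0∞ := fun i k => (∫⁻ k', ‖F i k'‖ₑ ^ (1 / w i) * K (k - k') ∂μ) / M with hBf
  have hFm : ∀ i, AEMeasurable (fun k' => ‖F i k'‖ₑ) μ := fun i =>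
    (hfF i).integrableOn.aestronglyMeasurable.aemeasurable.enorm
  have h2 : ∀ k, ∏ i, ‖smoothedFT d N (F i) k‖ₑ ≤ ∑ i, ENNReal.ofReal (w i) * Bf i k := by
    intro k
    calc ∏ i, ‖smoothedFT d N (F i) k‖ₑ ≤ ∏ i, A i k :=
          Finset.prod_le_prod' fun i _ => enorm_smoothedFT_le N (F i) k
      _ ≤ ∑ i, ENNReal.ofReal (w i) * A i k ^ (1 / w i) :=
          prod_le_sum_mul_rpow _ (fun i _ => hw i) hw1 _
      _ ≤ ∑ i, ENNReal.ofReal (w i) * Bf i k := by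
          gcongr with i _
          exact rpow_lintegral_mul_div_le (hKm.comp (measurable_const.sub measurable_id)).aemeasurable
            (hFm i) (lintegral_fejerKernel_sub' N k) hM0 hMt (one_le_one_div (hw i) (weight_le_one hw hw1 i))
  -- integrate: `∫⁻ Bf_i = ∫⁻ ‖F_i‖^{p_i}`
  have hunc : ∀ i, AEMeasurable (Function.uncurry fun (k k' : Fin d → ℝ) => ‖F i k'‖ₑ ^ (1 / w i) * K (k - k'))
      (μ.prod μ) := by
    intro i
    change AEMeasurable (fun p : (Fin d → ℝ) × (Fin d → ℝ) => ‖F i p.2‖ₑ ^ (1 / w i) * K (p.1 - p.2)) (μ.prod μ)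
    exact ((hFm i).pow_const _).comp_snd.mul (hKm.comp (measurable_fst.sub measurable_snd)).aemeasurable
  have hBm : ∀ i, AEMeasurable (Bf i) μ := fun i => (hunc i).lintegral_prod_right'.div_const _
  have h3 : ∀ i, ∫⁻ k, Bf i k ∂μ = ∫⁻ k', ‖F i k'‖ₑ ^ (1 / w i) ∂μ := by
    intro i
    simp only [hBf]
    simp_rw [ENNReal.div_eq_inv_mul]
    rw [lintegral_const_mul' _ _ (ENNReal.inv_ne_top.2 hM0), lintegral_lintegral_swap (hunc i)]
    have hin : ∀ k', ∫⁻ k, ‖F i k'‖ₑ ^ (1 / w i) * K (k - k') ∂μ = ‖F i k'‖ₑ ^ (1 / w i) * M := by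
      intro k'
      rw [lintegral_const_mul (f := fun k : Fin d → ℝ => K (k - k')) _
        (hKm.comp (measurable_id.sub measurable_const))]
      simp only [hK, hμ]
      rw [lintegral_fejerKernel_sub N k']
    simp_rw [hin]
    rw [lintegral_mul_const'' _ ((hFm i).pow_const _), ← mul_assoc, mul_comm M⁻¹, mul_assoc,
      ENNReal.inv_mul_cancel hM0 hMt, mul_one]
  calc ENNReal.ofReal Φ ≤ (∫⁻ k, ∏ i, ‖smoothedFT d N (F i) k‖ₑ ∂μ) / M := h1
    _ ≤ (∫⁻ k, ∑ i, ENNReal.ofReal (w i) * Bf i k ∂μ) / M := by gcongr; exact h2 _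
    _ = (∑ i, ENNReal.ofReal (w i) * ∫⁻ k in cube d, ‖F i k‖ₑ ^ (1 / w i)) / M := by
        rw [lintegral_finsetSum' _ fun i _ => (hBm i).const_mul _]
        congr 1
        refine Finset.sum_congr rfl fun i _ => ?_
        rw [lintegral_const_mul'' _ (hBm i), h3 i]

/-- **Diagram bound (finite form)**: for `f_1, …, f_n ≥ 0` on `ℤ^d` with Fourier representatives
`F_i ∈ L¹([-π,π]^d)` and weights `w_i > 0`, `Σ w_i = 1`, every finite part of the constrained sum
obeys `Σ_{y ∈ S, Σ_i y_i = a} Π_i f_i(y_i) ≤ (2π)^{-d} Σ_i w_i ∫_{[-π,π]^d} ‖F_i‖^{1/w_i}`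
(in `[0, ∞]`). For `n = 2, 3, 4` these are bounds on `W^{(β,γ)}(a)`, `T^{(β,γ)}(a)`,
`S^{(γ)}(a)` by `L^{p}`-norms of the representatives of `G^{(β)}` — the rigorous form of
"the first integral is finite if `4 + β + γ < d`" etc. [cite: Hara2008, §4.1.1–§4.1.2 ((4.5)–(4.8), (4.13)–(4.14))] -/
theorem ofReal_sum_prod_le {n : ℕ} {f : Fin n → Site d → ℝ} {F : Fin n → (Fin d → ℝ) → ℂ}
    (hfF : ∀ i, IsFourierPair (f i) (F i)) (hf : ∀ i y, 0 ≤ f i y)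
    {w : Fin n → ℝ} (hw : ∀ i, 0 < w i) (hw1 : ∑ i, w i = 1) (a : Site d) (S : Finset (Fin n → Site d)) :
    ENNReal.ofReal (∑ y ∈ S with (∑ i, y i = a), ∏ i, f i (y i)) ≤
      (∑ i, ENNReal.ofReal (w i) * ∫⁻ k in cube d, ‖F i k‖ₑ ^ (1 / w i)) / ENNReal.ofReal ((2 * Real.pi) ^ d) := by
  classical
  obtain ⟨L, hL⟩ := exists_subset_piFinset_box S
  -- the regularised partial sums converge to the partial sum
  have hlim : Tendsto (fun N => ∑ y ∈ S with (∑ i, y i = a), ∏ i, f i (y i) * fejerWeight d N (y i)) atTop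
      (𝓝 (∑ y ∈ S with (∑ i, y i = a), ∏ i, f i (y i))) := by
    refine tendsto_finsetSum _ fun y _ => tendsto_finsetProd _ fun i _ => ?_
    simpa using (tendsto_fejerWeight (d := d) (y i)).const_mul (f i (y i))
  -- and are eventually bounded by the full regularised diagram
  have hle : ∀ᶠ N in atTop, ENNReal.ofReal (∑ y ∈ S with (∑ i, y i = a), ∏ i, f i (y i) * fejerWeight d N (y i)) ≤
      (∑ i, ENNReal.ofReal (w i) * ∫⁻ k in cube d, ‖F i k‖ₑ ^ (1 / w i)) / ENNReal.ofReal ((2 * Real.pi) ^ d) := by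
    filter_upwards [eventually_ge_atTop L] with N hN
    refine le_trans (ENNReal.ofReal_le_ofReal ?_) (ofReal_sum_prod_fejerWeight_le hfF hf hw hw1 a N)
    refine Finset.sum_le_sum_of_subset_of_nonneg (fun y hy => ?_) (fun y _ _ =>
      Finset.prod_nonneg fun i _ => mul_nonneg (hf i _) (fejerWeight_nonneg d N _))
    rw [Finset.mem_filter] at hy ⊢
    refine ⟨Fintype.mem_piFinset.2 fun i => box_mono d (by omega) (hL y hy.1 i), hy.2⟩
  exact le_of_tendsto ((ENNReal.continuous_ofReal.tendsto _).comp hlim) hle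

/-- **Diagram bound (`tsum` form)**: `Σ_{Σ_i y_i = a} Π_i f_i(y_i) ≤ (2π)^{-d} Σ_i w_i ∫ ‖F_i‖^{1/w_i}`
in `[0, ∞]`, uniformly in `a`. [cite: Hara2008, §4.1.1–§4.1.2 ((4.5)–(4.8))] -/
theorem tsum_prod_le {n : ℕ} {f : Fin n → Site d → ℝ} {F : Fin n → (Fin d → ℝ) → ℂ}
    (hfF : ∀ i, IsFourierPair (f i) (F i)) (hf : ∀ i y, 0 ≤ f i y)
    {w : Fin n → ℝ} (hw : ∀ i, 0 < w i) (hw1 : ∑ i, w i = 1) (a : Site d) :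
    ∑' y : {y : Fin n → Site d // ∑ i, y i = a}, ENNReal.ofReal (∏ i, f i (y.1 i)) ≤
      (∑ i, ENNReal.ofReal (w i) * ∫⁻ k in cube d, ‖F i k‖ₑ ^ (1 / w i)) / ENNReal.ofReal ((2 * Real.pi) ^ d) := by
  classical
  rw [ENNReal.tsum_eq_iSup_sum]
  refine iSup_le fun s => ?_
  set S : Finset (Fin n → Site d) := s.map (Function.Embedding.subtype _) with hS
  have hSf : S.filter (fun y => ∑ i, y i = a) = S := by
    refine Finset.filter_true_of_mem fun y hy => ?_
    rw [hS, Finset.mem_map] at hy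
    obtain ⟨z, -, rfl⟩ := hy
    exact z.2
  have hsum : ∑ y ∈ s, ENNReal.ofReal (∏ i, f i (y.1 i)) = ENNReal.ofReal (∑ y ∈ S with (∑ i, y i = a), ∏ i, f i (y i)) := by
    rw [hSf, hS, Finset.sum_map, ENNReal.ofReal_sum_of_nonneg fun y _ => Finset.prod_nonneg fun i _ => hf i _]
    rfl
  rw [hsum]
  exact ofReal_sum_prod_le hfF hf hw hw1 a S

end HaraNorms

end Literature.Barriers.CriticalPhenomena
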